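import Summits.QuantumFields.BalabanUV.Beta.KernelWardResponse
import Summits.QuantumFields.BalabanUV.Beta.KernelWardRemainderParity
import Summits.QuantumFields.BalabanUV.Beta.SpineRecursiveParity

/-!
# `BalabanUV.Beta.KernelWardResidual` — binder row D1, W-side socket (L4) of the Ward binder hW: THE RESIDUAL OF `hWd` IS LOCALISED FOR
# FREE AND TADPOLE-NULL BY PARITY — the END's `X₂`-slot may be taken `0`
# (β sub-cell, lineage an1 = «direct one-loop in Bałaban's gauge», gen 27; sequel of `KernelWardResponse`, `KernelWardRemainderParity`)

NOT IN PRINT; OUR BOOKKEEPING.  HONEST FRAMING (cell contract, verbatim): «discharging `BetaPertH` makes Bałaban's UV stability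
UNCONDITIONAL — a real constructive-QFT result; it is NOT the continuum limit and NOT the Clay problem.»  HONEST DEPENDENCY (verbatim):
«continuum YM on T⁴ ⇐ BetaPertH ∧ nine spine estimates (0/9 proved); BetaPertH ⇐ (D1) ∧ (D4) ∧ CAP+tail; G-an2-4 gates asym, D1 and
NE2/3/4.»  This module is [folklore] linear algebra and exponential bookkeeping over tree objects BY NAME; it types no statement of Bałaban's
papers, carries no `[cite:]` tag and no `Prop` fact, instantiates NO binder of the β-function wall, and is NOT D1, NOT `BetaPertH`, NOT
continuum, NOT Clay.

## What is proved, and where it sits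

`KernelWardResponse.divW_W2OfK_of_tableLaws_response` computed the `(μ, y)`-divergence of an2's carrier modulo the bare table laws:
`divW (W2OfK K N S M S₂ M₂) y ν y′ = conjV (dM K N S M ν y′) (X y) + 𝒩 y ν y′`, with THE RESIDUAL
`𝒩 y ν y′ := dM K N (R y) (R^M y) ν y′ − c_H • 𝒟_{S,M}[(K ∘ dM K N S M ν y′) ĝ_y]`, where `𝒟_{S,M}[A]` is the first-order superposition of the
tables `S`, `M` with THE GAUGE READ OF `A` — the weights `(u, a) ↦ Σ′_{x₂} Σ_{κ₂} A u x₂ a (inl κ₂) · ĝ_y κ₂ x₂`,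
`ĝ_y = KernelWardRelative.gaugeWt N y`.
The socket `hWd` of `WardLocusRecursiveEnd.wardTransversal_flipK_TbalOf_JsRecBmAtOf` wants `conjW 𝕄 0 V′ X 0 X₂ + Nr` with `X₂`, `Nr`
localised (`hX₂`, `hNr`), `X₂` axial-even (`hEX₂`) and `tadpole G_j Nr = 0` (`hN0`).  THIS FILE shows that the choice `X₂ := 0`, `Nr := 𝒩`
meets the two SCALAR sockets from TABLE-LEVEL inputs only:

* §1 `abs_gaugeWt_le_one`, `abs_gaugeRead_le`: the gauge read of a kernel bi-localised at `(p, q)` decays from `p` (rate kept, constant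
  `(d+1)·C·Zl δ`).
* §2 `biLoc_gaugeSup`: for localised tables `S` (`LocStencil`), `M` (`VertexFamily`) the superposition `𝒟_{S,M}[A]` is bi-localised at `(p, p)`.
* §3 PARITY TRANSPORT (`parityOdd_sum`, `parityOdd_smul`, `parityOdd_gaugeSup`): ROW-WISE parity-odd tables (`trK (S κ u) = −sgnK (S κ u)`,
  same for `M`) give a parity-odd superposition FOR ANY scalar weights (engine: an1's `KernelWardRemainderParity.parityOdd_wsum/_cwsum/_add`).
* §4 THE RESIDUAL: `loc_residual` (hNr: `Loc 𝒩` from `Decays K`, `LocStencil (R y)`, `VertexFamily (R^M y)`, `LocStencil S`, `VertexFamily M` —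
  NO parity, NO law), `parityOdd_residual` (row parities of `S`, `M`, `R y`, `R^M y` ⇒ `trK 𝒩 = −sgnK 𝒩`), `tadpole_residual_eq_zero`
  (hN0: `+ Spr K`, `trK K = sgnK K` ⇒ `tadpole K 𝒩 = 0`, by `KernelWardRelativeEnd.tadpole_eq_zero_of_parity`).
* §5 THE WALL INSTANCE over `G_j = coDressKBmAt (toSite r) Lc (KInvStep Lc j)`, every level, every in-block root (`G_j` is spread by
  `decays_coDressKBmAt_KInvStep` and sgn-symmetric by `BubbleParity.trK_coDressKBmAt_KInvStep`): `loc_residual_coDressKBmAt_KInvStep`,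
  `tadpole_residual_coDressKBmAt_KInvStep_eq_zero`.

So, on the PARITY ROUTE, `hWd` ⟸ {(T2-S₂), (T2-M₂) first-slot laws with remainders `R`, `R^M` (suppliers), (c1) (leaf-10 `LagrangeFold*`)},
`hX₂`/`hEX₂` are trivial (`X₂ = 0`), `hNr` ⟸ (R-loc) and `hN0` ⟸ (R-par) + (S-par) + (M-par) — all laws of the TABLES.

PARITY GRADES THE SOCKET (§3 `parityEven_conjV_diagK`): for parity-odd first-order tables the END's MAIN TERM `conjV V′ (diagK g)` is
parity-EVEN, while parity kills only the tadpole of a parity-ODD residual — so on this route the residual must be the parity-odd part of `hWd`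
and (R-par) amounts to «the parity-even part of the bare law (T2-S₂)/(T2-M₂) holds with ZERO remainder» (bookkeeping remark, not formalised
here; consistent with leaf-05's remainder-free traced (2,2) Wilson toy).  HONEST LIMITS.  (S-par)/(M-par)/(R-par) are HYPOTHESES on the tables,
typed as global block parities `trK T = −sgnK T`; for the level-0 pure table the tree has PLAIN leg-antisymmetry (`StepJetData.wilsonA_antisymm`,
`SpineRootedS0.S0At_antisymm`, cited by an3) — equal to the `sgnK` form on the ff block and differing by the `mfNeg` placement on the bordered
blocks, a convention to be matched with the symmetry type of `G_j` by the wiring seat; the parities of the `M1At` rows and of the literal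
second-order remainders are NOT decided here, and where a row is not parity-odd the scalar content `tadpole G_j (𝒩 j y ν y′) = 0` isolated by
§4 must come from a ROOTED reflection (an2's `bref` engine, (W-0W)/(W-0B)) instead (an1 `SKELETON-D1-L4-HW` v2.1).  Nothing here instantiates a
literal table.
-/

noncomputable section

open Finset
open scoped BigOperators
open Literature.MathematicalPhysics.QuantumFieldTheory
open Literature.MathematicalPhysics.QuantumFieldTheory.Balaban1983to89
open Literature.MathematicalPhysics.QuantumFieldTheory.Balaban1983to89.Beta
open B12Sec2to5 (l1 l1_nonneg)
open B6BondElimination (unitVec)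
open ExpKernelCalculus (MKer Decays BiLoc VertexFamily comp Zl tadpole Zl_nonneg summable_exp_shift' tsum_exp_shift' biLoc_comp_decays)
open KernelWard (divV divW biLoc_add biLoc_sub)
open AffineAveraging (Site box toSite)
open OneStepResolventKernel (Fib wsum LocStencil biLoc_mono decays_mono biLoc_wsum)
open OneStepKernelFamily (KInvStep colH vertexOfK)
open InterLevelTransport (cwsum biLoc_cwsum)
open SecondOrderResponse (colM vertexOfM dM K2OfK W2OfK vertexFamily_dM)
open Summit.QuantumFields.BalabanUV.Beta.TameKernelCalculus
open Summit.QuantumFields.BalabanUV.Beta.BorderedHessian (sgnF sgnK sgnK_apply stepScale diagK conjV_diagK_apply)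
open Summit.QuantumFields.BalabanUV.Beta.BubbleParity (sgnK_neg spr_of_decays trK_coDressKBmAt_KInvStep)
open Summit.QuantumFields.BalabanUV.Beta.ChartConjugation (conjV)
open Summit.QuantumFields.BalabanUV.Beta.AxialDressingRooted (coDressKBmAt decays_coDressKBmAt_KInvStep)
open Summit.QuantumFields.BalabanUV.Beta.KernelWardRelative (gaugeWt)
open Summit.QuantumFields.BalabanUV.Beta.KernelWardRelativeEnd (tadpole_eq_zero_of_parity)
open Summit.QuantumFields.BalabanUV.Beta.KernelWardRemainderParity (parityOdd_wsum parityOdd_cwsum parityOdd_add sgnK_add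
  trK_vertexOfK_eq_neg_sgnK_of_rows trK_vertexOfM_eq_neg_sgnK_of_rows)
open Summit.QuantumFields.BalabanUV.Beta.SpineRecursiveParity (parityOdd_sum parityOdd_smul)
open Summit.QuantumFields.BalabanUV.Beta.KernelWardHColumnWall (colH_ward_KInvStep_all)
open Summit.QuantumFields.BalabanUV.Beta.KernelWardMColumn (colM_coDressKBmAt_KInvStep_ward)
open Summit.QuantumFields.BalabanUV.Beta.KernelWardResponse (divW_W2OfK_of_tableLaws_response rowM_ward_of_packed
  coDressKBmAt_KInvStep_inr_inr_off)

namespace Summit.QuantumFields.BalabanUV.Beta.KernelWardResidual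

variable {d : ℕ}

/-! ## §1 The gauge read of a bi-localised kernel decays from its left centre -/

/-- [folklore] The pure-gauge weight takes values in `{−1, 0, 1}`; in particular `|ĝ_y κ u| ≤ 1`. -/
theorem abs_gaugeWt_le_one (N : ℕ) (y : Site (d + 1)) (κ : Fin (d + 1)) (u : Site (d + 1)) : |gaugeWt N y κ u| ≤ 1 := by
  unfold gaugeWt
  split_ifs <;> norm_num

/-- [folklore] One fine column of the gauge read: `|Σ_{κ₂} A u x₂ a (inl κ₂) · ĝ_y κ₂ x₂| ≤ (d+1) · C · e^{−δ(|u−p|₁ + |x₂−q|₁)}`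
for `A` bi-localised at `(p, q)`. -/
theorem abs_gaugeRead_term_le {N : ℕ} {A : MKer (d + 1) (Fib d)} {p q : Site (d + 1)} {C δ : ℝ} (hA : BiLoc A p q C δ)
    (y u x₂ : Site (d + 1)) (a : Fib d) :
    |∑ κ₂, A u x₂ a (Sum.inl κ₂) * gaugeWt N y κ₂ x₂| ≤
      ((d + 1 : ℕ) * C * Real.exp (-δ * l1 (u - p))) * Real.exp (-δ * l1 (x₂ - q)) := by
  calc |∑ κ₂, A u x₂ a (Sum.inl κ₂) * gaugeWt N y κ₂ x₂| ≤ ∑ κ₂, |A u x₂ a (Sum.inl κ₂) * gaugeWt N y κ₂ x₂| :=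
        Finset.abs_sum_le_sum_abs _ _
    _ ≤ ∑ _κ₂ : Fin (d + 1), C * Real.exp (-δ * (l1 (u - p) + l1 (x₂ - q))) := Finset.sum_le_sum fun κ₂ _ => by
        rw [abs_mul]
        calc |A u x₂ a (Sum.inl κ₂)| * |gaugeWt N y κ₂ x₂| ≤ |A u x₂ a (Sum.inl κ₂)| * 1 :=
              mul_le_mul_of_nonneg_left (abs_gaugeWt_le_one N y κ₂ x₂) (abs_nonneg _)
          _ ≤ C * Real.exp (-δ * (l1 (u - p) + l1 (x₂ - q))) := by rw [mul_one]; exact hA u x₂ a (Sum.inl κ₂)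
    _ = ((d + 1 : ℕ) * C * Real.exp (-δ * l1 (u - p))) * Real.exp (-δ * l1 (x₂ - q)) := by
        rw [Finset.sum_const, Finset.card_univ, Fintype.card_fin, nsmul_eq_mul, mul_add, Real.exp_add]
        ring

/-- [folklore] The gauge-read column family is summable in the fine position `x₂`. -/
theorem summable_gaugeRead {N : ℕ} {A : MKer (d + 1) (Fib d)} {p q : Site (d + 1)} {C δ : ℝ} (hA : BiLoc A p q C δ) (hδ : 0 < δ)
    (y u : Site (d + 1)) (a : Fib d) : Summable fun x₂ => ∑ κ₂, A u x₂ a (Sum.inl κ₂) * gaugeWt N y κ₂ x₂ :=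
  Summable.of_norm_bounded ((summable_exp_shift' hδ q).mul_left _)
    (fun x₂ => by rw [Real.norm_eq_abs]; exact abs_gaugeRead_term_le hA y u x₂ a)

/-- [folklore] **THE GAUGE READ OF A BI-LOCALISED KERNEL DECAYS FROM ITS LEFT CENTRE**: for `A` bi-localised at `(p, q)` (rate `δ > 0`,
constant `C`), the weight `(u, a) ↦ Σ′_{x₂} Σ_{κ₂} A u x₂ a (inl κ₂) · ĝ_y κ₂ x₂` is bounded by `(d+1)·C·Zl δ · e^{−δ|u−p|₁}` —
uniformly in the gauge block `y` (only `|ĝ_y| ≤ 1` is used). -/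
theorem abs_gaugeRead_le {N : ℕ} {A : MKer (d + 1) (Fib d)} {p q : Site (d + 1)} {C δ : ℝ} (hA : BiLoc A p q C δ) (hδ : 0 < δ)
    (y u : Site (d + 1)) (a : Fib d) :
    |∑' x₂, ∑ κ₂, A u x₂ a (Sum.inl κ₂) * gaugeWt N y κ₂ x₂| ≤ ((d + 1 : ℕ) * C * Zl (d + 1) δ) * Real.exp (-δ * l1 (u - p)) := by
  have hs := summable_gaugeRead (N := N) hA hδ y u a
  calc |∑' x₂, ∑ κ₂, A u x₂ a (Sum.inl κ₂) * gaugeWt N y κ₂ x₂| ≤ ∑' x₂, |∑ κ₂, A u x₂ a (Sum.inl κ₂) * gaugeWt N y κ₂ x₂| := by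
        have h := norm_tsum_le_tsum_norm hs.norm
        simpa only [Real.norm_eq_abs] using h
    _ ≤ ∑' x₂, ((d + 1 : ℕ) * C * Real.exp (-δ * l1 (u - p))) * Real.exp (-δ * l1 (x₂ - q)) :=
        Summable.tsum_le_tsum (fun x₂ => abs_gaugeRead_term_le hA y u x₂ a) hs.abs ((summable_exp_shift' hδ q).mul_left _)
    _ = ((d + 1 : ℕ) * C * Zl (d + 1) δ) * Real.exp (-δ * l1 (u - p)) := by
        rw [tsum_mul_left, tsum_exp_shift']
        ring

/-! ## §2 The first-order superposition of localised tables with gauge-read weights is bi-localised -/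

section Sup

variable {N : ℕ} [NeZero N]

/-- [folklore] **`𝒟_{S,M}[A]` IS BI-LOCALISED**: for `A` bi-localised at `(p, q)` and localised tables `S` (`LocStencil S Cs δ`),
`M` (`VertexFamily M N CM δ`), the superposition of the tables with the gauge read of `A` as weights,
`Σ_κ wsum (u ↦ Σ′Σ A u x₂ (inl κ)(inl κ₂) ĝ_y κ₂ x₂) (S κ) + Σ_ρ cwsum N (w ↦ Σ′Σ A (N•w) x₂ (inr ρ)(inl κ₂) ĝ_y κ₂ x₂)
(M ρ)`, is bi-localised at `(p, p)` (rate `δ/2`; `OneStepResolventKernel.biLoc_wsum`, `InterLevelTransport.biLoc_cwsum`). -/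
theorem biLoc_gaugeSup {A : MKer (d + 1) (Fib d)} {p q : Site (d + 1)} {C δ : ℝ} (hA : BiLoc A p q C δ) (hδ : 0 < δ)
    {S : Fin (d + 1) → Site (d + 1) → MKer (d + 1) (Fib d)} {Cs : ℝ} (hS : LocStencil S Cs δ)
    {M : Fin (d + 1) → Site (d + 1) → MKer (d + 1) (Fib d)} {CM : ℝ} (hM : VertexFamily M N CM δ) (y : Site (d + 1)) :
    BiLoc (∑ κ, wsum (fun u => ∑' x₂, ∑ κ₂, A u x₂ (Sum.inl κ) (Sum.inl κ₂) * gaugeWt N y κ₂ x₂) (S κ)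
        + ∑ ρ, cwsum N (fun w => ∑' x₂, ∑ κ₂, A ((N : ℤ) • w) x₂ (Sum.inr ρ) (Sum.inl κ₂) * gaugeWt N y κ₂ x₂) (M ρ)) p p
      ((d + 1 : ℕ) * ((d + 1 : ℕ) * C * Zl (d + 1) δ * Cs * Zl (d + 1) (δ / 2))
        + (d + 1 : ℕ) * ((d + 1 : ℕ) * C * Zl (d + 1) δ * CM * Zl (d + 1) (δ / 2))) (δ / 2) := by
  have hC : 0 ≤ C := hA.nonneg (Sum.inl 0)
  have hC' : 0 ≤ (d + 1 : ℕ) * C * Zl (d + 1) δ := by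
    have := Zl_nonneg (D := d + 1) hδ
    positivity
  have h1 : ∀ κ : Fin (d + 1), BiLoc (wsum (fun u => ∑' x₂, ∑ κ₂, A u x₂ (Sum.inl κ) (Sum.inl κ₂) * gaugeWt N y κ₂ x₂) (S κ)) p p
      ((d + 1 : ℕ) * C * Zl (d + 1) δ * Cs * Zl (d + 1) (δ / 2)) (δ / 2) := fun κ =>
    biLoc_wsum (fun u => abs_gaugeRead_le hA hδ y u (Sum.inl κ)) (fun u => hS κ u) hδ hC'
  have h2 : ∀ ρ : Fin (d + 1), BiLoc (cwsum N (fun w => ∑' x₂, ∑ κ₂, A ((N : ℤ) • w) x₂ (Sum.inr ρ) (Sum.inl κ₂) * gaugeWt N y κ₂ x₂)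
      (M ρ)) p p ((d + 1 : ℕ) * C * Zl (d + 1) δ * CM * Zl (d + 1) (δ / 2)) (δ / 2) := fun ρ =>
    biLoc_cwsum (fun w => abs_gaugeRead_le hA hδ y ((N : ℤ) • w) (Sum.inr ρ)) (fun w => hM ρ w) hδ hC'
  have hs1 := KernelWard.biLoc_finset_sum Finset.univ (fun κ _ => h1 κ)
  have hs2 := KernelWard.biLoc_finset_sum Finset.univ (fun ρ _ => h2 ρ)
  simp only [Finset.sum_const, Finset.card_univ, Fintype.card_fin, nsmul_eq_mul] at hs1 hs2
  exact biLoc_add hs1 hs2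

end Sup

/-! ## §3 Parity transport: row-wise parity-odd tables give a parity-odd superposition, any scalar weights -/

-- COURIER DEDUP DELTA (leaf-05-g4, gate `dedup.landed`, pre-authorised by the author l.10132): `parityOdd_sum` and `parityOdd_smul`
-- are IMPORTED from `SpineRecursiveParity` (p214244) instead of being restated here; statements identical.

/-- [folklore] Parity-oddness is closed under subtraction. -/
theorem parityOdd_sub {A B : MKer (d + 1) (Fib d)} (hA : trK A = -sgnK A) (hB : trK B = -sgnK B) : trK (A - B) = -sgnK (A - B) := by
  rw [sub_eq_add_neg]
  refine parityOdd_add hA ?_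
  rw [trK_neg, hB, sgnK_neg, neg_neg]

/-- [folklore] **PARITY TRANSPORT THROUGH THE FIRST-ORDER SUPERPOSITION**: if every row of `S` and of `M` is parity-odd
(`trK (S κ u) = −sgnK (S κ u)`, `trK (M ρ w) = −sgnK (M ρ w)`) then, FOR ANY scalar weights, `Σ_κ wsum (w_κ) (S κ) + Σ_ρ cwsum N (w′_ρ) (M ρ)` is
parity-odd (an1's `KernelWardRemainderParity.parityOdd_wsum` / `parityOdd_cwsum`). -/
theorem parityOdd_gaugeSup {N : ℕ} (wS wM : Fin (d + 1) → Site (d + 1) → ℝ)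
    {S : Fin (d + 1) → Site (d + 1) → MKer (d + 1) (Fib d)} (hSp : ∀ κ u, trK (S κ u) = -sgnK (S κ u))
    {M : Fin (d + 1) → Site (d + 1) → MKer (d + 1) (Fib d)} (hMp : ∀ ρ w, trK (M ρ w) = -sgnK (M ρ w)) :
    trK (∑ κ, wsum (wS κ) (S κ) + ∑ ρ, cwsum N (wM ρ) (M ρ)) = -sgnK (∑ κ, wsum (wS κ) (S κ) + ∑ ρ, cwsum N (wM ρ) (M ρ)) :=
  parityOdd_add (parityOdd_sum _ fun κ _ => parityOdd_wsum _ (hSp κ)) (parityOdd_sum _ fun ρ _ => parityOdd_cwsum _ (hMp ρ))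

/-- [folklore] The first-order vertex `dM K N S M ν y′` of row-wise parity-odd tables is parity-odd (`KernelWardRemainderParity`, summed). -/
theorem parityOdd_dM {N : ℕ} (K : MKer (d + 1) (Fib d)) {S : Fin (d + 1) → Site (d + 1) → MKer (d + 1) (Fib d)}
    (hSp : ∀ κ u, trK (S κ u) = -sgnK (S κ u)) {M : Fin (d + 1) → Site (d + 1) → MKer (d + 1) (Fib d)}
    (hMp : ∀ ρ w, trK (M ρ w) = -sgnK (M ρ w)) (ν : Fin (d + 1)) (y' : Site (d + 1)) :
    trK (dM K N S M ν y') = -sgnK (dM K N S M ν y') :=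
  parityOdd_add (trK_vertexOfK_eq_neg_sgnK_of_rows K hSp ν y') (trK_vertexOfM_eq_neg_sgnK_of_rows K hMp ν y')

/-- [folklore] **PARITY GRADES THE SOCKET — THE MAIN TERM IS PARITY-EVEN**: the commutator of a parity-ODD kernel with a DIAGONAL kernel is
parity-EVEN, `trK (conjV T (diagK g)) = +sgnK (conjV T (diagK g))` (`conjV_diagK_apply`: entries `T x z a b · (g z b − g x a)`).  So the END's
`conjV V′ (diagK g)` and a parity-killable residual live in opposite parity sectors. -/
theorem parityEven_conjV_diagK (g : Site (d + 1) → Fib d → ℝ) {T : MKer (d + 1) (Fib d)} (h : trK T = -sgnK T) :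
    trK (conjV T (diagK g)) = sgnK (conjV T (diagK g)) := by
  funext x z a b
  have e := congrArg (fun K => K x z a b) h
  simp only [trK_apply, Pi.neg_apply, sgnK_apply] at e
  simp only [trK_apply, sgnK_apply]
  rw [conjV_diagK_apply, conjV_diagK_apply, e]
  ring

/-! ## §4 The residual of `hWd`: localised for free, parity-odd from row parities, hence tadpole-null -/

section Residual

variable {N : ℕ} [NeZero N]

/-- [folklore] **SOCKET `hNr` — THE RESIDUAL IS LOCALISED, NO LAW AND NO PARITY USED**: for a decaying `K`, localised first-order tables `S`, `M`
and localised remainder tables `R y`, `R^M y`, the residual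
`𝒩 y ν y′ = dM K N (R y) (R^M y) ν y′ − c_H • 𝒟_{S,M}[(K ∘ dM K N S M ν y′) ĝ_y]` is `Loc` (bi-localised at the coarse point `N•y′`:
`SecondOrderResponse.vertexFamily_dM`, `ExpKernelCalculus.biLoc_comp_decays`, §2). -/
theorem loc_residual {K : MKer (d + 1) (Fib d)} {C m : ℝ} (hK : Decays K C m) (hC : 0 ≤ C) (hm : 0 < m)
    {S : Fin (d + 1) → Site (d + 1) → MKer (d + 1) (Fib d)} {Cs : ℝ} (hS : LocStencil S Cs m)
    {M : Fin (d + 1) → Site (d + 1) → MKer (d + 1) (Fib d)} {CM : ℝ} (hM : VertexFamily M N CM m)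
    {R : Site (d + 1) → Fin (d + 1) → Site (d + 1) → MKer (d + 1) (Fib d)} {CR : ℝ} (hR : ∀ y, LocStencil (R y) CR m)
    {RM : Site (d + 1) → Fin (d + 1) → Site (d + 1) → MKer (d + 1) (Fib d)} {CRM : ℝ} (hRM : ∀ y, VertexFamily (RM y) N CRM m)
    (cH : ℝ) (y : Site (d + 1)) (ν : Fin (d + 1)) (y' : Site (d + 1)) :
    Loc (dM K N (R y) (RM y) ν y'
      - cH • (∑ κ, wsum (fun u => ∑' x₂, ∑ κ₂,
            comp K (dM K N S M ν y') u x₂ (Sum.inl κ) (Sum.inl κ₂) * gaugeWt N y κ₂ x₂) (S κ)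
          + ∑ ρ, cwsum N (fun w => ∑' x₂, ∑ κ₂,
            comp K (dM K N S M ν y') ((N : ℤ) • w) x₂ (Sum.inr ρ) (Sum.inl κ₂) * gaugeWt N y κ₂ x₂) (M ρ))) := by
  -- the remainder vertex is a vertex family
  have hV : BiLoc (dM K N (R y) (RM y) ν y') ((N : ℤ) • y') ((N : ℤ) • y') _ (m / 2) := vertexFamily_dM hK hC (hR y) (hRM y) hm le_rfl ν y'
  -- the response kernel `K ∘ dM K N S M ν y′` is bi-localised at the coarse point, rate `m/4`
  have hD : BiLoc (dM K N S M ν y') ((N : ℤ) • y') ((N : ℤ) • y') _ (m / 2) := vertexFamily_dM hK hC hS hM hm le_rfl ν y'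
  have hK2 : Decays K C (m / 2) := decays_mono hK hC le_rfl (by linarith)
  have hA : BiLoc (comp K (dM K N S M ν y')) ((N : ℤ) • y') ((N : ℤ) • y') _ (m / 4) :=
    biLoc_comp_decays hK2 hD (by positivity) (by linarith)
  have hm4 : 0 < m / 4 := by positivity
  have hS' : LocStencil S Cs (m / 4) := fun κ u => biLoc_mono (hS κ u) ((hS κ u).nonneg (Sum.inl 0)) (by linarith)
  have hM' : VertexFamily M N CM (m / 4) := fun ρ w => biLoc_mono (hM ρ w) ((hM ρ w).nonneg (Sum.inl 0)) (by linarith)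
  have hSup := biLoc_gaugeSup hA hm4 hS' hM' y
  exact Loc.sub ⟨_, _, _, _, by positivity, hV⟩ (Loc.smul cH ⟨_, _, _, _, by positivity, hSup⟩)

omit [NeZero N] in
/-- [folklore] **THE RESIDUAL IS PARITY-ODD** when every row of `S`, `M`, `R y`, `R^M y` is parity-odd — any `K`, any contact constant. -/
theorem parityOdd_residual (K : MKer (d + 1) (Fib d)) {S : Fin (d + 1) → Site (d + 1) → MKer (d + 1) (Fib d)}
    (hSp : ∀ κ u, trK (S κ u) = -sgnK (S κ u)) {M : Fin (d + 1) → Site (d + 1) → MKer (d + 1) (Fib d)}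
    (hMp : ∀ ρ w, trK (M ρ w) = -sgnK (M ρ w)) {R : Site (d + 1) → Fin (d + 1) → Site (d + 1) → MKer (d + 1) (Fib d)}
    (hRp : ∀ y κ u, trK (R y κ u) = -sgnK (R y κ u)) {RM : Site (d + 1) → Fin (d + 1) → Site (d + 1) → MKer (d + 1) (Fib d)}
    (hRMp : ∀ y ρ w, trK (RM y ρ w) = -sgnK (RM y ρ w)) (cH : ℝ) (y : Site (d + 1)) (ν : Fin (d + 1)) (y' : Site (d + 1)) :
    trK (dM K N (R y) (RM y) ν y'
      - cH • (∑ κ, wsum (fun u => ∑' x₂, ∑ κ₂,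
            comp K (dM K N S M ν y') u x₂ (Sum.inl κ) (Sum.inl κ₂) * gaugeWt N y κ₂ x₂) (S κ)
          + ∑ ρ, cwsum N (fun w => ∑' x₂, ∑ κ₂,
            comp K (dM K N S M ν y') ((N : ℤ) • w) x₂ (Sum.inr ρ) (Sum.inl κ₂) * gaugeWt N y κ₂ x₂) (M ρ)))
    = -sgnK (dM K N (R y) (RM y) ν y'
      - cH • (∑ κ, wsum (fun u => ∑' x₂, ∑ κ₂,
            comp K (dM K N S M ν y') u x₂ (Sum.inl κ) (Sum.inl κ₂) * gaugeWt N y κ₂ x₂) (S κ)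
          + ∑ ρ, cwsum N (fun w => ∑' x₂, ∑ κ₂,
            comp K (dM K N S M ν y') ((N : ℤ) • w) x₂ (Sum.inr ρ) (Sum.inl κ₂) * gaugeWt N y κ₂ x₂) (M ρ))) :=
  parityOdd_sub (parityOdd_dM K (hRp y) (hRMp y) ν y') (parityOdd_smul cH (parityOdd_gaugeSup _ _ hSp hMp))

/-- [folklore] **SOCKET `hN0` ON THE PARITY ROUTE — THE TADPOLE OF THE RESIDUAL VANISHES**: for a spread, sgn-symmetric propagator
(`Spr K`, `trK K = sgnK K`), localised tables and row-wise parity-odd `S`, `M`, `R y`, `R^M y`:  `tadpole K (𝒩 y ν y′) = 0`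
(`KernelWardRelativeEnd.tadpole_eq_zero_of_parity`).  The first-slot table laws are NOT used: tadpole-nullity of the residual is a
property of the TABLES' parities, whatever the generator `X` and the contact constant. -/
theorem tadpole_residual_eq_zero {K : MKer (d + 1) (Fib d)} {C m : ℝ} (hK : Decays K C m) (hC : 0 ≤ C) (hm : 0 < m)
    (hKt : trK K = sgnK K)
    {S : Fin (d + 1) → Site (d + 1) → MKer (d + 1) (Fib d)} {Cs : ℝ} (hS : LocStencil S Cs m) (hSp : ∀ κ u, trK (S κ u) = -sgnK (S κ u))
    {M : Fin (d + 1) → Site (d + 1) → MKer (d + 1) (Fib d)} {CM : ℝ} (hM : VertexFamily M N CM m)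
    (hMp : ∀ ρ w, trK (M ρ w) = -sgnK (M ρ w))
    {R : Site (d + 1) → Fin (d + 1) → Site (d + 1) → MKer (d + 1) (Fib d)} {CR : ℝ} (hR : ∀ y, LocStencil (R y) CR m)
    (hRp : ∀ y κ u, trK (R y κ u) = -sgnK (R y κ u))
    {RM : Site (d + 1) → Fin (d + 1) → Site (d + 1) → MKer (d + 1) (Fib d)} {CRM : ℝ} (hRM : ∀ y, VertexFamily (RM y) N CRM m)
    (hRMp : ∀ y ρ w, trK (RM y ρ w) = -sgnK (RM y ρ w)) (cH : ℝ) (y : Site (d + 1)) (ν : Fin (d + 1)) (y' : Site (d + 1)) :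
    tadpole K (dM K N (R y) (RM y) ν y'
      - cH • (∑ κ, wsum (fun u => ∑' x₂, ∑ κ₂,
            comp K (dM K N S M ν y') u x₂ (Sum.inl κ) (Sum.inl κ₂) * gaugeWt N y κ₂ x₂) (S κ)
          + ∑ ρ, cwsum N (fun w => ∑' x₂, ∑ κ₂,
            comp K (dM K N S M ν y') ((N : ℤ) • w) x₂ (Sum.inr ρ) (Sum.inl κ₂) * gaugeWt N y κ₂ x₂) (M ρ))) = 0 :=
  tadpole_eq_zero_of_parity ⟨C, m, hm, hK⟩ hKt (loc_residual hK hC hm hS hM hR hRM cH y ν y')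
    (parityOdd_residual K hSp hMp hRp hRMp cH y ν y')

/-- [folklore] **THE `(μ, y)`-DIVERGENCE OF THE CARRIER IS THE FIRST-ORDER COMMUTATOR PLUS THE RESIDUAL** — `hWd` with `X₂ := 0`:
`divW (W2OfK K N S M S₂ M₂) y ν y′ = conjV (dM K N S M ν y′) (X y) + 𝒩 y ν y′` (an1's `KernelWardResponse.divW_W2OfK_of_tableLaws_response`,
regrouped); with (c1) (leaf-10 `LagrangeFoldStep.vertexOfK_lagrangePiece_eq_M1At`) the commutator is the END's `conjV V′_j (X_j y)`. -/
theorem divW_W2OfK_eq_conjV_add_residual {K : MKer (d + 1) (Fib d)} {C m : ℝ} (hK : Decays K C m) (hC : 0 ≤ C) (hm : 0 < m)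
    {S : Fin (d + 1) → Site (d + 1) → MKer (d + 1) (Fib d)} {Cs : ℝ} (hS : LocStencil S Cs m)
    {M : Fin (d + 1) → Site (d + 1) → MKer (d + 1) (Fib d)} {CM : ℝ} (hM : VertexFamily M N CM m)
    {S₂ : Fin (d + 1) → Site (d + 1) → Fin (d + 1) → Site (d + 1) → MKer (d + 1) (Fib d)} {B₂ : ℝ}
    (hB₂ : ∀ κ u κ' u' x z a b, |S₂ κ u κ' u' x z a b| ≤ B₂)
    {M₂ : Fin (d + 1) → Site (d + 1) → Fin (d + 1) → Site (d + 1) → MKer (d + 1) (Fib d)} {B₂' : ℝ}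
    (hB₂' : ∀ κ u ρ w x z a b, |M₂ κ u ρ w x z a b| ≤ B₂') (cH : ℝ)
    (hH : ∀ (y : Site (d + 1)) (κ' : Fin (d + 1)) (u : Site (d + 1)),
      ∑ μ, (colH K N μ (y - unitVec μ) κ' u - colH K N μ y κ' u) = cH * gaugeWt N y κ' u)
    (hMw : ∀ (y : Site (d + 1)) (ρ : Fin (d + 1)) (w : Site (d + 1)), ∑ μ, (colM K N μ (y - unitVec μ) ρ w - colM K N μ y ρ w) = 0)
    (hoff : ∀ (x : Site (d + 1)), Literature.Probability.LatticeModels.Torus.proj N x ≠ 0 →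
      ∀ (z : Site (d + 1)) (ρ μ : Fin (d + 1)), K x z (Sum.inr ρ) (Sum.inr μ) = 0)
    {X : Site (d + 1) → MKer (d + 1) (Fib d)} (hX : ∀ y, Spr (X y))
    {R : Site (d + 1) → Fin (d + 1) → Site (d + 1) → MKer (d + 1) (Fib d)} {BR : ℝ} (hRb : ∀ y κ u x z a b, |R y κ u x z a b| ≤ BR)
    {RM : Site (d + 1) → Fin (d + 1) → Site (d + 1) → MKer (d + 1) (Fib d)} {BR' : ℝ} (hRMb : ∀ y ρ w x z a b, |RM y ρ w x z a b| ≤ BR')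
    (hS₂ : ∀ (y : Site (d + 1)) (κ' : Fin (d + 1)) (u' : Site (d + 1)),
      cH • ∑ v ∈ box (d + 1) N, divV (fun κ u => S₂ κ u κ' u') ((N : ℤ) • y + toSite v) =
        comp (S κ' u') (X y) - comp (X y) (S κ' u') + R y κ' u')
    (hM₂ : ∀ (y : Site (d + 1)) (ρ : Fin (d + 1)) (w : Site (d + 1)),
      cH • ∑ v ∈ box (d + 1) N, divV (fun κ u => M₂ κ u ρ w) ((N : ℤ) • y + toSite v) =
        comp (M ρ w) (X y) - comp (X y) (M ρ w) + RM y ρ w)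
    (y : Site (d + 1)) (ν : Fin (d + 1)) (y' : Site (d + 1)) :
    divW (W2OfK K N S M S₂ M₂) y ν y' =
      conjV (dM K N S M ν y') (X y) + (dM K N (R y) (RM y) ν y'
        - cH • (∑ κ, wsum (fun u => ∑' x₂, ∑ κ₂,
            comp K (dM K N S M ν y') u x₂ (Sum.inl κ) (Sum.inl κ₂) * gaugeWt N y κ₂ x₂) (S κ)
          + ∑ ρ, cwsum N (fun w => ∑' x₂, ∑ κ₂,
            comp K (dM K N S M ν y') ((N : ℤ) • w) x₂ (Sum.inr ρ) (Sum.inl κ₂) * gaugeWt N y κ₂ x₂) (M ρ))) := by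
  rw [divW_W2OfK_of_tableLaws_response hK hC hm hS hM hB₂ hB₂' cH hH hMw hoff hX hRb hRMb hS₂ hM₂ y ν y', add_sub_assoc]

end Residual

/-! ## §5 The wall instance: `G_j = coDressKBmAt (toSite r) Lc (KInvStep Lc j)`, every level, every in-block root -/

section Wall

variable {Lc : ℕ} [NeZero Lc] {r : Fin (d + 1) → ℕ}

/-- [folklore] **SOCKET `hNr` FOR THE WALL**: the residual over `G_j`, with contact `c_H = (stepScale d Lc j · Lc^{d+1})⁻¹`, is localised —
for localised tables only (`decays_coDressKBmAt_KInvStep` supplies the propagator's decay). -/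
theorem loc_residual_coDressKBmAt_KInvStep (hr : r ∈ box (d + 1) Lc) (j : ℕ) {m : ℝ} (hm : 0 < m)
    {S : Fin (d + 1) → Site (d + 1) → MKer (d + 1) (Fib d)} {Cs : ℝ} (hS : LocStencil S Cs m)
    {M : Fin (d + 1) → Site (d + 1) → MKer (d + 1) (Fib d)} {CM : ℝ} (hM : VertexFamily M Lc CM m)
    {R : Site (d + 1) → Fin (d + 1) → Site (d + 1) → MKer (d + 1) (Fib d)} {CR : ℝ} (hR : ∀ y, LocStencil (R y) CR m)
    {RM : Site (d + 1) → Fin (d + 1) → Site (d + 1) → MKer (d + 1) (Fib d)} {CRM : ℝ} (hRM : ∀ y, VertexFamily (RM y) Lc CRM m)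
    (y : Site (d + 1)) (ν : Fin (d + 1)) (y' : Site (d + 1)) :
    Loc (dM (coDressKBmAt (toSite r) Lc (KInvStep (d := d) Lc j)) Lc (R y) (RM y) ν y'
      - (stepScale d Lc j * (Lc : ℝ) ^ (d + 1))⁻¹ • (∑ κ, wsum (fun u => ∑' x₂, ∑ κ₂,
            comp (coDressKBmAt (toSite r) Lc (KInvStep (d := d) Lc j))
              (dM (coDressKBmAt (toSite r) Lc (KInvStep (d := d) Lc j)) Lc S M ν y') u x₂ (Sum.inl κ) (Sum.inl κ₂) *
            gaugeWt Lc y κ₂ x₂) (S κ)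
          + ∑ ρ, cwsum Lc (fun w => ∑' x₂, ∑ κ₂,
            comp (coDressKBmAt (toSite r) Lc (KInvStep (d := d) Lc j))
              (dM (coDressKBmAt (toSite r) Lc (KInvStep (d := d) Lc j)) Lc S M ν y') ((Lc : ℤ) • w) x₂ (Sum.inr ρ) (Sum.inl κ₂) *
            gaugeWt Lc y κ₂ x₂) (M ρ))) := by
  obtain ⟨δ, C, hδ, hC, hG⟩ := decays_coDressKBmAt_KInvStep (d := d) hr j
  have hm₀ : 0 < min m δ := lt_min hm hδ
  have hG' : Decays (coDressKBmAt (toSite r) Lc (KInvStep (d := d) Lc j)) C (min m δ) := decays_mono hG hC le_rfl (min_le_right _ _)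
  have hS' : LocStencil S Cs (min m δ) := fun κ u => biLoc_mono (hS κ u) ((hS κ u).nonneg (Sum.inl 0)) (min_le_left _ _)
  have hM' : VertexFamily M Lc CM (min m δ) := fun ρ w => biLoc_mono (hM ρ w) ((hM ρ w).nonneg (Sum.inl 0)) (min_le_left _ _)
  have hR' : ∀ y, LocStencil (R y) CR (min m δ) := fun y κ u =>
    biLoc_mono (hR y κ u) ((hR y κ u).nonneg (Sum.inl 0)) (min_le_left _ _)
  have hRM' : ∀ y, VertexFamily (RM y) Lc CRM (min m δ) := fun y ρ w =>
    biLoc_mono (hRM y ρ w) ((hRM y ρ w).nonneg (Sum.inl 0)) (min_le_left _ _)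
  exact loc_residual hG' hC hm₀ hS' hM' hR' hRM' _ y ν y'

/-- [folklore] **SOCKET `hN0` FOR THE WALL, PARITY ROUTE**: the `G_j`-tadpole of the residual vanishes at every level `j` and every in-block
root, for localised ROW-WISE PARITY-ODD tables `S`, `M`, `R y`, `R^M y` (`G_j` spread: `decays_coDressKBmAt_KInvStep`; sgn-symmetric:
`BubbleParity.trK_coDressKBmAt_KInvStep`).  See HONEST LIMITS in the module docstring for which literal tables are row-wise parity-odd. -/
theorem tadpole_residual_coDressKBmAt_KInvStep_eq_zero (hr : r ∈ box (d + 1) Lc) (j : ℕ) {m : ℝ} (hm : 0 < m)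
    {S : Fin (d + 1) → Site (d + 1) → MKer (d + 1) (Fib d)} {Cs : ℝ} (hS : LocStencil S Cs m) (hSp : ∀ κ u, trK (S κ u) = -sgnK (S κ u))
    {M : Fin (d + 1) → Site (d + 1) → MKer (d + 1) (Fib d)} {CM : ℝ} (hM : VertexFamily M Lc CM m)
    (hMp : ∀ ρ w, trK (M ρ w) = -sgnK (M ρ w))
    {R : Site (d + 1) → Fin (d + 1) → Site (d + 1) → MKer (d + 1) (Fib d)} {CR : ℝ} (hR : ∀ y, LocStencil (R y) CR m)
    (hRp : ∀ y κ u, trK (R y κ u) = -sgnK (R y κ u))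
    {RM : Site (d + 1) → Fin (d + 1) → Site (d + 1) → MKer (d + 1) (Fib d)} {CRM : ℝ} (hRM : ∀ y, VertexFamily (RM y) Lc CRM m)
    (hRMp : ∀ y ρ w, trK (RM y ρ w) = -sgnK (RM y ρ w)) (y : Site (d + 1)) (ν : Fin (d + 1)) (y' : Site (d + 1)) :
    tadpole (coDressKBmAt (toSite r) Lc (KInvStep (d := d) Lc j))
      (dM (coDressKBmAt (toSite r) Lc (KInvStep (d := d) Lc j)) Lc (R y) (RM y) ν y'
      - (stepScale d Lc j * (Lc : ℝ) ^ (d + 1))⁻¹ • (∑ κ, wsum (fun u => ∑' x₂, ∑ κ₂,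
            comp (coDressKBmAt (toSite r) Lc (KInvStep (d := d) Lc j))
              (dM (coDressKBmAt (toSite r) Lc (KInvStep (d := d) Lc j)) Lc S M ν y') u x₂ (Sum.inl κ) (Sum.inl κ₂) *
            gaugeWt Lc y κ₂ x₂) (S κ)
          + ∑ ρ, cwsum Lc (fun w => ∑' x₂, ∑ κ₂,
            comp (coDressKBmAt (toSite r) Lc (KInvStep (d := d) Lc j))
              (dM (coDressKBmAt (toSite r) Lc (KInvStep (d := d) Lc j)) Lc S M ν y') ((Lc : ℤ) • w) x₂ (Sum.inr ρ) (Sum.inl κ₂) *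
            gaugeWt Lc y κ₂ x₂) (M ρ))) = 0 := by
  have hKs : Spr (coDressKBmAt (toSite r) Lc (KInvStep (d := d) Lc j)) := spr_of_decays (decays_coDressKBmAt_KInvStep hr j)
  exact tadpole_eq_zero_of_parity hKs (trK_coDressKBmAt_KInvStep hr j)
    (loc_residual_coDressKBmAt_KInvStep hr j hm hS hM hR hRM y ν y') (parityOdd_residual _ hSp hMp hRp hRMp _ y ν y')

end Wall

end Summit.QuantumFields.BalabanUV.Beta.KernelWardResidual

end
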